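import Summits.HodgeConjecture.CorCM.TwoSexticFieldsJointFrame
import Summits.HodgeConjecture.CorCM.DihedralSexticPairCurveHodgeOfMarkmanNonGalois
import HarnessLib

/-!
# COR-CM — TWO non-isomorphic sextic fields over one quadratic field: the separation hypotheses from
# `Hom(K₁, K₂) = ∅`, frames with a prescribed place, and the normalisation of one CM type

Cell `pub-hodgecm2` (COR-CM), seat b30 gen 16 (2026-08-21); COUNT-NEUTRAL; theorems only, no definition, no named fact,
no `sorry`.  Fifth file of the series TWO-FIELD-PAIR: the field-theoretic inputs of the intrinsic theorem
(`CorCM/TwoSexticFieldsThreefoldPairHodgeOfMarkman.lean`).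

* §1 **`exists_ringEquiv_comp_eq_and_apply_ne`** — Galois correspondence inside `ℂ` for a conjugate field: if
  `y ∈ ℂ` is algebraic over `ℚ` and NOT in `t₀(K)` (`t₀ : K → ℂ` a number field), some automorphism of `ℂ` fixes
  `t₀(K)` pointwise and moves `y` (second root of the minimal polynomial of `y` over `t₀(K)`; `Aut(ℂ)` is transitive on
  the embeddings of the countable field `t₀(K)(y)`, the tree's `ZarhinLie.exists_ringEquiv_complex_comp_eq`) — the
  general form of gen 14's `NonGaloisField.exists_ringEquiv_comp_eq_and_comp_ne` [cite: Lang2002, V §3 and VI §1];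
* §2 `nonempty_ringHom_of_stabilizer_le` — if the stabiliser of `t : K₂ → ℂ` in `Aut(ℂ)` fixes `s : K₁ → ℂ`, then
  `s(K₁) ⊆ t(K₂)` and `K₁` embeds in `K₂`; `nonempty_ringHom_symm_of_finrank_eq` — a ring map between number fields
  of the same degree inverts;
* §3 `exists_stabilizer_le_of_kernel_trivial` — in the two-fibre setting of `CorCM/TwoSexticFieldsJointFrame.lean`: if
  every automorphism fixing the `τ`-fibre of `K₂` pointwise fixes that of `K₁` pointwise (trivial left kernel), then the
  stabiliser of `t₂ 0` fixes some `t₁ p` (it maps to `{1, a}` with `a² = 1` in `S₃`, which has a fixed point);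
  **`exists_fix_move_of_isEmpty`** — hence `Hom(K₁, K₂) = ∅` gives the separation hypothesis `hsep₁` of
  `exists_ringEquiv_forall_comp_eq_perm₂` [cite: Lang2002, I §12 Exercise 5, VI §1 Thm. 1.14];
* §4 `exists_realisation_card_fibre_eq_one₁` — a realisation `B ⊨ (K; Φ)` with `Φ` not induced from `k` may be replaced
  (same `B`, conjugate structure `IsCMTypeRealisation.transport c_K`) by one whose type has exactly ONE member over `τ`
  [cite: Shimura1998, §5.2, §8.4]; **`exists_frame_place`** — for such a type and ANY place `p₀ ∈ ℤ/3` a frame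
  `e : Hom(K, ℂ) ≃ ℤ/3 × Bool` adapted to an enumeration `t` of the `τ`-fibre (`e (t q) = (q, true)`) reading `Φ` as
  «sign `true` exactly over the place `p₀`» (gen 14's `exists_frame_of_card_fibre_eq_one`, one type, free place)
  [cite: Lang2002, VI §1 Thm. 1.14] [cite: Shimura1998, §18.2].

## References
* [Lang2002] S. Lang, *Algebra*, 3rd ed., I §12 Ex. 5, V §3, VI §1.  [Shimura1998] G. Shimura, *Abelian Varieties with
  Complex Multiplication and Modular Functions* (1998), §5.2, §8.4, §18.2.
-/

noncomputable section

open Polynomial IntermediateField NumberField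

namespace Summit.HodgeConjecture.CorCM.TwoSexticFields

open Summit.HodgeConjecture.CorCM.NonGaloisField

/-! ## §1 Galois correspondence inside `ℂ` for a conjugate field -/

section Correspondence

variable {K : Type} [Field K] [NumberField K]

/-- **If `y` is algebraic and `y ∉ t₀(K)`, some automorphism of `ℂ` fixes `t₀(K)` pointwise and moves `y`.**
[cite: Lang2002, V §3 Thm. 3.3 and VI §1] -/
theorem exists_ringEquiv_comp_eq_and_apply_ne (t₀ : K →+* ℂ) {y : ℂ} (hy : IsIntegral ℚ y)
    (hyr : y ∉ Set.range t₀) : ∃ σ : ℂ ≃+* ℂ, (σ : ℂ →+* ℂ).comp t₀ = t₀ ∧ σ y ≠ y := by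
  classical
  -- the conjugate field `K₀ = t₀(K) ⊂ ℂ`
  set K₀ : IntermediateField ℚ ℂ := t₀.toRatAlgHom.fieldRange with hK₀_def
  have hyK₀ : y ∉ K₀ := fun h => hyr (by
    obtain ⟨a, ha⟩ := AlgHom.mem_fieldRange.1 h
    exact ⟨a, ha⟩)
  have hyint : IsIntegral K₀ y := hy.tower_top
  -- the minimal polynomial of `y` over `K₀` has a second complex root `y'`
  set q := minpoly K₀ y with hq_def
  have hq2 : 2 ≤ q.natDegree := by
    rw [hq_def, minpoly.two_le_natDegree_iff hyint]
    rintro ⟨z, hz⟩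
    exact hyK₀ (by rw [← hz]; exact z.2)
  have hqsep : q.Separable := (minpoly.irreducible hyint).separable
  have hcard : Fintype.card (q.rootSet ℂ) = q.natDegree :=
    card_rootSet_eq_natDegree hqsep (IsAlgClosed.splits _)
  have hy_root : y ∈ q.rootSet ℂ := by
    rw [mem_rootSet]
    exact ⟨minpoly.ne_zero hyint, minpoly.aeval K₀ y⟩
  obtain ⟨⟨y', hy'⟩, hne⟩ := Fintype.exists_ne_of_one_lt_card (by rw [hcard]; omega) (⟨y, hy_root⟩ : q.rootSet ℂ)
  have hne' : y' ≠ y := fun h => hne (Subtype.ext h)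
  have hy'a : y' ∈ q.aroots ℂ := by
    rw [mem_rootSet'] at hy'
    exact mem_aroots'.2 ⟨hy'.1, hy'.2⟩
  -- two `K₀`-embeddings of `K₀(y)`: the inclusion and `y ↦ y'`
  set u₁ : K₀⟮y⟯ →ₐ[K₀] ℂ := (K₀⟮y⟯).val with hu₁
  set u₂ : K₀⟮y⟯ →ₐ[K₀] ℂ := (algHomAdjoinIntegralEquiv K₀ hyint).symm ⟨y', hy'a⟩ with hu₂
  have hu₂gen : u₂ (AdjoinSimple.gen K₀ y) = y' := algHomAdjoinIntegralEquiv_symm_apply_gen K₀ hyint ⟨y', hy'a⟩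
  -- `K₀(y)` is countable, so `Aut(ℂ)` carries `u₁` to `u₂`
  haveI : Countable K := Countable.of_equiv _ (Module.finBasis ℚ K).equivFun.toEquiv.symm
  haveI : Countable K₀ := by
    have hc : (Set.range t₀).Countable := Set.countable_range _
    have : (K₀ : Set ℂ) = Set.range t₀ := by
      rw [hK₀_def, AlgHom.coe_fieldRange]; rfl
    rw [← this] at hc
    exact hc.to_subtype
  haveI : FiniteDimensional K₀ K₀⟮y⟯ := adjoin.finiteDimensional hyint
  haveI : Countable K₀⟮y⟯ :=
    Countable.of_equiv _ (Module.finBasis K₀ K₀⟮y⟯).equivFun.toEquiv.symm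
  obtain ⟨σ, hσ⟩ := Literature.AlgebraicGeometry.Motives.ZarhinLie.exists_ringEquiv_complex_comp_eq
    u₁.toRingHom u₂.toRingHom
  refine ⟨σ, RingHom.ext fun a => ?_, fun h => hne' ?_⟩
  · -- `σ` fixes `t₀(K)` pointwise
    have ha : t₀ a ∈ K₀ := AlgHom.mem_fieldRange.2 ⟨a, rfl⟩
    have h1 := hσ (algebraMap K₀ K₀⟮y⟯ ⟨t₀ a, ha⟩)
    rw [AlgHom.toRingHom_eq_coe, AlgHom.toRingHom_eq_coe, AlgHom.coe_toRingHom, AlgHom.coe_toRingHom,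
      AlgHom.commutes, AlgHom.commutes] at h1
    exact h1
  · -- `σ y = y'`
    have h1 := hσ (AdjoinSimple.gen K₀ y)
    rw [AlgHom.toRingHom_eq_coe, AlgHom.toRingHom_eq_coe, AlgHom.coe_toRingHom, AlgHom.coe_toRingHom, hu₂gen,
      hu₁] at h1
    change σ ((AdjoinSimple.gen K₀ y : K₀⟮y⟯) : ℂ) = y' at h1
    rw [AdjoinSimple.coe_gen] at h1
    rw [← h1, h]

end Correspondence

/-! ## §2 Embeddings from stabilisers -/

section Stabiliser

variable {K₁ K₂ : Type} [Field K₁] [NumberField K₁] [Field K₂] [NumberField K₂]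

/-- **If the stabiliser of `t : K₂ → ℂ` in `Aut(ℂ)` fixes `s : K₁ → ℂ`, then `K₁` embeds in `K₂`** (`s(K₁) ⊆ t(K₂)` by
§1, and `t` is a bijection onto its range). [cite: Lang2002, VI §1 Thm. 1.14] -/
theorem nonempty_ringHom_of_stabilizer_le {s : K₁ →+* ℂ} {t : K₂ →+* ℂ}
    (h : ∀ σ : ℂ ≃+* ℂ, (σ : ℂ →+* ℂ).comp t = t → (σ : ℂ →+* ℂ).comp s = s) : Nonempty (K₁ →+* K₂) := by
  -- `s(K₁) ⊆ t(K₂)`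
  have hrange : ∀ x : K₁, s x ∈ Set.range t := by
    intro x
    by_contra hx
    have hint : IsIntegral ℚ (s x) := (IsIntegral.of_finite ℚ x).map s.toRatAlgHom
    obtain ⟨σ, hσt, hσx⟩ := exists_ringEquiv_comp_eq_and_apply_ne t hint hx
    exact hσx (by simpa using RingHom.congr_fun (h σ hσt) x)
  have hle : s.range ≤ t.range := by
    rintro z ⟨x, rfl⟩
    obtain ⟨w, hw⟩ := hrange x
    exact ⟨w, hw⟩
  have hbij : Function.Bijective t.rangeRestrict :=
    ⟨fun a b hab => t.injective (by simpa using congrArg Subtype.val hab), RingHom.rangeRestrict_surjective t⟩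
  exact ⟨(RingEquiv.ofBijective t.rangeRestrict hbij).symm.toRingHom.comp
    ((Subring.inclusion hle).comp s.rangeRestrict)⟩

/-- **A ring map between number fields of the same degree inverts.** [folklore] -/
theorem nonempty_ringHom_symm_of_finrank_eq (f : K₂ →+* K₁)
    (h : Module.finrank ℚ K₁ = Module.finrank ℚ K₂) : Nonempty (K₁ →+* K₂) := by
  have hinj : Function.Injective f.toRatAlgHom.toLinearMap := f.injective
  have hsurj : Function.Surjective f.toRatAlgHom.toLinearMap :=
    (LinearMap.injective_iff_surjective_of_finrank_eq_finrank h.symm).1 hinj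
  exact ⟨(RingEquiv.ofBijective f ⟨f.injective, hsurj⟩).symm.toRingHom⟩

end Stabiliser

/-! ## §3 Trivial kernel ⟹ an embedding; hence `Hom(K₁, K₂) = ∅` separates the fibres -/

section Kernel

/-- The stabiliser of a point of `ℤ/3` in `S₃` has exponent `2`. [folklore] -/
theorem perm_sq_eq_one_of_apply_zero : ∀ b : Equiv.Perm (ZMod 3), b 0 = 0 → b * b = 1 := by
  decide +kernel

/-- An involution of `ℤ/3` has a fixed point. [folklore] -/
theorem perm_exists_fixed_of_sq_eq_one : ∀ a : Equiv.Perm (ZMod 3), a * a = 1 → ∃ p, a p = p := by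
  decide +kernel

set_option synthInstance.maxSize 4096 in
set_option synthInstance.maxHeartbeats 400000 in
/-- The stabiliser of a point of `ℤ/3` in `S₃` has two elements. [folklore] -/
theorem perm_stabilizer_two : ∀ b b' : Equiv.Perm (ZMod 3), b 0 = 0 → b' 0 = 0 → b = 1 ∨ b' = 1 ∨ b = b' := by
  decide +kernel

variable {K₁ K₂ : Type} [Field K₁] [Field K₂]
  {k : Type} [Field k] {i₁ : k →+* K₁} {i₂ : k →+* K₂} {τ : k →+* ℂ}
  {t₁ : ZMod 3 → (K₁ →+* ℂ)} (ht₁ : Function.Injective t₁) (hti₁ : ∀ p, (t₁ p).comp i₁ = τ)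
  (htcov₁ : ∀ s : K₁ →+* ℂ, s.comp i₁ = τ → ∃ p, s = t₁ p)
  {t₂ : ZMod 3 → (K₂ →+* ℂ)} (ht₂ : Function.Injective t₂) (hti₂ : ∀ p, (t₂ p).comp i₂ = τ)
  (htcov₂ : ∀ s : K₂ →+* ℂ, s.comp i₂ = τ → ∃ p, s = t₂ p)

/-- Undoing a realised permutation: `σ ∘ t p = t (b p)` for all `p` gives `σ⁻¹ ∘ t (b p) = t p`. [folklore] -/
theorem symm_comp_eq_of_comp_eq {σ : ℂ ≃+* ℂ} {b : Equiv.Perm (ZMod 3)}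
    (h : ∀ p, (σ : ℂ →+* ℂ).comp (t₂ p) = t₂ (b p)) (p : ZMod 3) :
    (σ.symm : ℂ →+* ℂ).comp (t₂ (b p)) = t₂ p := by
  refine RingHom.ext fun x => ?_
  have e1 := RingHom.congr_fun (h p) x
  simp only [RingHom.coe_comp, RingHom.coe_coe, Function.comp_apply] at e1 ⊢
  rw [← e1, RingEquiv.symm_apply_apply]

include ht₁ hti₁ htcov₁ ht₂ hti₂ htcov₂ in
/-- **Trivial left kernel ⟹ the stabiliser of `t₂ 0` fixes some `t₁ p`.**  If every automorphism of `ℂ` fixing the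
`τ`-fibre of `K₂` pointwise fixes that of `K₁` pointwise, then the permutation of the fibre of `K₁` induced by a
`σ` fixing `t₂ 0` depends only on the one induced on the fibre of `K₂` (an element of the two-element stabiliser of
`0`), and squares to `1`; an involution of `ℤ/3` fixes a point. [cite: Lang2002, I §12 Exercise 5] -/
theorem exists_stabilizer_le_of_kernel_trivial
    (hN : ∀ σ : ℂ ≃+* ℂ, (∀ p, (σ : ℂ →+* ℂ).comp (t₂ p) = t₂ p) → ∀ p, (σ : ℂ →+* ℂ).comp (t₁ p) = t₁ p) :
    ∃ p, ∀ σ : ℂ ≃+* ℂ, (σ : ℂ →+* ℂ).comp (t₂ 0) = t₂ 0 → (σ : ℂ →+* ℂ).comp (t₁ p) = t₁ p := by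
  by_cases hall : ∀ σ : ℂ ≃+* ℂ, (σ : ℂ →+* ℂ).comp (t₂ 0) = t₂ 0 → ∀ p, (σ : ℂ →+* ℂ).comp (t₁ p) = t₁ p
  · exact ⟨0, fun σ hσ => hall σ hσ 0⟩
  push Not at hall
  obtain ⟨σs, hs0, hsmove⟩ := hall
  -- the permutations realised by `σs`
  have hsτ : (σs : ℂ →+* ℂ).comp τ = τ := comp_eq_self_of_comp_t₁ hti₂ hs0
  obtain ⟨a, ha⟩ := exists_perm_of_comp_eq ht₁ hti₁ htcov₁ hsτ
  obtain ⟨b, hb⟩ := exists_perm_of_comp_eq ht₂ hti₂ htcov₂ hsτ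
  have hb0 : b 0 = 0 := ht₂ ((hb 0).symm.trans hs0)
  have hb1 : b ≠ 1 := by
    intro hb1
    obtain ⟨p₁, hp₁⟩ := hsmove
    exact hp₁ (hN σs (fun p => by rw [hb p, hb1, Equiv.Perm.one_apply]) p₁)
  -- `a² = 1`: `σs²` fixes the fibre of `K₂` pointwise (`b² = 1`), hence that of `K₁`
  have hbb : b * b = 1 := perm_sq_eq_one_of_apply_zero b hb0
  have hss : ∀ p, ((σs.trans σs : ℂ ≃+* ℂ) : ℂ →+* ℂ).comp (t₁ p) = t₁ ((a * a) p) := by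
    intro p
    have hc : ((σs.trans σs : ℂ ≃+* ℂ) : ℂ →+* ℂ).comp (t₁ p) = (σs : ℂ →+* ℂ).comp ((σs : ℂ →+* ℂ).comp (t₁ p)) :=
      RingHom.ext fun _ => rfl
    rw [hc, ha, ha, Equiv.Perm.mul_apply]
  have hss₂ : ∀ p, ((σs.trans σs : ℂ ≃+* ℂ) : ℂ →+* ℂ).comp (t₂ p) = t₂ p := by
    intro p
    have hc : ((σs.trans σs : ℂ ≃+* ℂ) : ℂ →+* ℂ).comp (t₂ p) = (σs : ℂ →+* ℂ).comp ((σs : ℂ →+* ℂ).comp (t₂ p)) :=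
      RingHom.ext fun _ => rfl
    rw [hc, hb, hb, ← Equiv.Perm.mul_apply, hbb, Equiv.Perm.one_apply]
  have haa : a * a = 1 := by
    ext p
    have h := (hss p).symm.trans (hN _ hss₂ p)
    rw [Equiv.Perm.one_apply, ht₁ h]
  obtain ⟨p₀, hp₀⟩ := perm_exists_fixed_of_sq_eq_one a haa
  refine ⟨p₀, fun σ hσ => ?_⟩
  have hστ : (σ : ℂ →+* ℂ).comp τ = τ := comp_eq_self_of_comp_t₁ hti₂ hσ
  obtain ⟨b', hb'⟩ := exists_perm_of_comp_eq ht₂ hti₂ htcov₂ hστ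
  have hb'0 : b' 0 = 0 := ht₂ ((hb' 0).symm.trans hσ)
  rcases perm_stabilizer_two b b' hb0 hb'0 with h1 | h1 | h1
  · exact absurd h1 hb1
  · -- `σ` fixes the fibre of `K₂` pointwise
    exact hN σ (fun p => by rw [hb' p, h1, Equiv.Perm.one_apply]) p₀
  · -- `σs⁻¹ σ` fixes the fibre of `K₂` pointwise, so `σ` acts on the fibre of `K₁` as `σs` does
    have hρ₂ : ∀ p, ((σ.trans σs.symm : ℂ ≃+* ℂ) : ℂ →+* ℂ).comp (t₂ p) = t₂ p := by
      intro p
      have hc : ((σ.trans σs.symm : ℂ ≃+* ℂ) : ℂ →+* ℂ).comp (t₂ p) =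
          (σs.symm : ℂ →+* ℂ).comp ((σ : ℂ →+* ℂ).comp (t₂ p)) := RingHom.ext fun _ => rfl
      rw [hc, hb', ← h1, symm_comp_eq_of_comp_eq hb p]
    have hρ₁ := hN _ hρ₂ p₀
    have hc : ((σ.trans σs.symm : ℂ ≃+* ℂ) : ℂ →+* ℂ).comp (t₁ p₀) =
        (σs.symm : ℂ →+* ℂ).comp ((σ : ℂ →+* ℂ).comp (t₁ p₀)) := RingHom.ext fun _ => rfl
    rw [hc] at hρ₁
    -- apply `σs` to both sides
    refine RingHom.ext fun x => ?_
    have e1 := RingHom.congr_fun hρ₁ x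
    have e2 := RingHom.congr_fun (ha p₀) x
    simp only [RingHom.coe_comp, RingHom.coe_coe, Function.comp_apply] at e1 e2 ⊢
    rw [hp₀] at e2
    have e3 := congrArg σs e1
    rw [RingEquiv.apply_symm_apply] at e3
    rw [e3, e2]

include ht₁ hti₁ htcov₁ ht₂ hti₂ htcov₂ in
/-- **`Hom(K₁, K₂) = ∅` separates the fibres**: some automorphism of `ℂ` fixes the `τ`-fibre of `K₂` pointwise and
moves that of `K₁` — the hypothesis `hsep₁` of `exists_ringEquiv_forall_comp_eq_perm₂` (else §3 and §2 would embed
`K₁` into `K₂`). [cite: Lang2002, I §12 Exercise 5, VI §1 Thm. 1.14] -/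
theorem exists_fix_move_of_isEmpty [NumberField K₁] [NumberField K₂] (h12 : IsEmpty (K₁ →+* K₂)) :
    ∃ σ : ℂ ≃+* ℂ, (∀ p, (σ : ℂ →+* ℂ).comp (t₂ p) = t₂ p) ∧ ∃ p, (σ : ℂ →+* ℂ).comp (t₁ p) ≠ t₁ p := by
  by_contra hno
  push Not at hno
  obtain ⟨p, hp⟩ := exists_stabilizer_le_of_kernel_trivial ht₁ hti₁ htcov₁ ht₂ hti₂ htcov₂ hno
  obtain ⟨f⟩ := nonempty_ringHom_of_stabilizer_le (s := t₁ p) (t := t₂ 0) hp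
  exact h12.false f

end Kernel

/-! ## §4 One CM type: normalisation and the frame with a prescribed place -/

section OneType

open Literature.AlgebraicGeometry Literature.AlgebraicGeometry.Motives
open Literature.AlgebraicGeometry.ComplexMultiplication (IsCMTypeRealisation)
open Literature.NumberTheory.Automorphic.PicardCM.CMCode (cmTypeMap)

open scoped Classical

variable {K : Type} [Field K] [NumberField K] [IsCMField K] {k : Type} [Field k] {i : k →+* K} {τ : k →+* ℂ}
  (hττ : ComplexEmbedding.conjugate τ ≠ τ)
  (hdich : ∀ s : K →+* ℂ, s.comp i = τ ∨ s.comp i = ComplexEmbedding.conjugate τ)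

include hττ hdich in
/-- **Normalising one type to one member over `τ`.**  A realisation `B ⊨ (K; Φ)` with `Φ` not induced from `k`
(`hprim`) may be replaced — same `B`, possibly the conjugate structure `(ι ∘ 𝓞(c_K), θ ∘ c_K)` realising `Φ̄`
(`IsCMTypeRealisation.transport`) — by one whose type has exactly ONE member over `τ`. [cite: Shimura1998, §5.2, §8.4] -/
theorem exists_realisation_card_fibre_eq_one₁ (h6 : Module.finrank ℚ K = 6)
    {B : AbelianVariety ℂ} {Φ : CMType K} {ι : 𝓞 K →+* CategoryTheory.End B}
    {θ : K →+* Module.End ℂ (Literature.AlgebraicGeometry.HodgeTheory.complexBetti B.X 1)}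
    (hB : IsCMTypeRealisation Φ B ι θ) (hprim : ∃ s ∈ Φ.1, ∃ s' ∈ Φ.1, s.comp i ≠ s'.comp i) :
    ∃ (Φ' : CMType K) (ι' : 𝓞 K →+* CategoryTheory.End B)
      (θ' : K →+* Module.End ℂ (Literature.AlgebraicGeometry.HodgeTheory.complexBetti B.X 1)),
      IsCMTypeRealisation Φ' B ι' θ' ∧
        (Finset.univ.filter fun s : K →+* ℂ => s.comp i = τ ∧ s ∈ Φ'.1).card = 1 := by
  rcases DihedralSexticPair.card_fibre_mem_eq_one_or_two hττ hdich h6 hprim with h1 | ⟨h12, -⟩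
  · exact ⟨Φ, ι, θ, hB, h1⟩
  · set c : K ≃+* K := (IsCMField.complexConj K).toRingEquiv with hc
    refine ⟨cmTypeMap c Φ, ι.comp (RingOfIntegers.mapRingEquiv c.symm).toRingHom, θ.comp c.symm.toRingHom,
      hB.transport c, DihedralSexticPair.card_fibre_mem_eq_one_of_compl hττ hdich h6 (fun s => ?_) h12⟩
    exact DihedralSexticPair.mem_cmTypeMap_complexConj_iff Φ s

include hττ hdich in
/-- **The frame with a prescribed place.**  `K/ℚ` not Galois of degree `6` over `(k, i, τ)`, `Φ` a type with exactly
one member over `τ`, `p₀ ∈ ℤ/3`: there are an enumeration `t` of the `τ`-fibre (injective, onto) and a frame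
`e : Hom(K, ℂ) ≃ ℤ/3 × Bool` adapted to it (`e (t q) = (q, true)`, `e ((t q)‾) = (q, false)`, conjugation flips the
sign, sign `true` iff over `τ`) in which `Φ = {sign = [place = p₀]}`. [cite: Lang2002, VI §1 Thm. 1.14]
[cite: Shimura1998, §18.2] -/
theorem exists_frame_place (hK : ¬ IsGalois ℚ K) (h6 : Module.finrank ℚ K = 6) {Φ : CMType K}
    (hone : (Finset.univ.filter fun s : K →+* ℂ => s.comp i = τ ∧ s ∈ Φ.1).card = 1) (p₀ : ZMod 3) :
    ∃ (t : ZMod 3 → (K →+* ℂ)) (e : (K →+* ℂ) ≃ ZMod 3 × Bool),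
      Function.Injective t ∧ (∀ q, (t q).comp i = τ) ∧ (∀ s : K →+* ℂ, s.comp i = τ → ∃ q, s = t q) ∧
      (∀ q, e (t q) = (q, true)) ∧ (∀ q, e (ComplexEmbedding.conjugate (t q)) = (q, false)) ∧
      (∀ s, ∃ q, s = t q ∨ s = ComplexEmbedding.conjugate (t q)) ∧
      (∀ s, e (ComplexEmbedding.conjugate s) = ((e s).1, !(e s).2)) ∧
      (∀ s, s.comp i = τ ↔ (e s).2 = true) ∧
      (∀ s, s ∈ Φ.1 ↔ (e s).2 = decide ((e s).1 = p₀)) := by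
  -- the distinguished member `s₀ ∈ Φ` over `τ`
  obtain ⟨s₀, hs₀⟩ := Finset.card_eq_one.1 hone
  have hmem₀ : ∀ s, (s.comp i = τ ∧ s ∈ Φ.1) ↔ s = s₀ := fun s => by
    have := Finset.ext_iff.1 hs₀ s
    simpa using this
  have hs₀τ : s₀.comp i = τ := ((hmem₀ s₀).2 rfl).1
  have hs₀Φ : s₀ ∈ Φ.1 := ((hmem₀ s₀).2 rfl).2
  -- two further members of the fibre
  have h3 := DihedralSexticPair.card_fibre_eq_three hττ hdich h6
  have h2 : ((Finset.univ.filter fun s : K →+* ℂ => s.comp i = τ).erase s₀).card = 2 := by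
    rw [Finset.card_erase_of_mem (by simp [hs₀τ]), h3]
  obtain ⟨s₁, s₂, h12, hpair⟩ := Finset.card_eq_two.1 h2
  have hs₁ : s₁ ∈ (Finset.univ.filter fun s : K →+* ℂ => s.comp i = τ).erase s₀ := by rw [hpair]; simp
  have hs₂ : s₂ ∈ (Finset.univ.filter fun s : K →+* ℂ => s.comp i = τ).erase s₀ := by rw [hpair]; simp
  simp only [Finset.mem_erase, Finset.mem_filter, Finset.mem_univ, true_and] at hs₁ hs₂
  -- the enumeration with `s₀` at the place `p₀`
  set t₀ : ZMod 3 → (K →+* ℂ) := ![s₀, s₁, s₂] with ht₀_def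
  have ht₀i : ∀ q, (t₀ q).comp i = τ := by
    intro q; fin_cases q
    · exact hs₀τ
    · exact hs₁.2
    · exact hs₂.2
  have ht₀ : Function.Injective t₀ := by
    intro p q hpq
    fin_cases p <;> fin_cases q
    · rfl
    · exact absurd hpq (Ne.symm hs₁.1)
    · exact absurd hpq (Ne.symm hs₂.1)
    · exact absurd hpq hs₁.1
    · rfl
    · exact absurd hpq h12
    · exact absurd hpq hs₂.1
    · exact absurd hpq (Ne.symm h12)
    · rfl
  set t : ZMod 3 → (K →+* ℂ) := fun q => t₀ (q - p₀) with ht_def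
  have hti : ∀ q, (t q).comp i = τ := fun q => ht₀i _
  have ht : Function.Injective t := fun p q hpq => by simpa using ht₀ hpq
  have htp₀ : t p₀ = s₀ := by simp [ht_def, ht₀_def]
  have htcov : ∀ s : K →+* ℂ, s.comp i = τ → ∃ q, s = t q := by
    intro s hs
    -- the fibre is the image of `t`
    have himg : (Finset.univ.filter fun s : K →+* ℂ => s.comp i = τ) = Finset.univ.image t := by
      symm
      apply Finset.eq_of_subset_of_card_le
      · intro x hx
        obtain ⟨q, -, rfl⟩ := Finset.mem_image.1 hx
        simp [hti q]
      · rw [h3, Finset.card_image_of_injective _ ht]; simp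
    have hs' : s ∈ Finset.univ.image t := by rw [← himg]; simp [hs]
    obtain ⟨q, -, hq⟩ := Finset.mem_image.1 hs'
    exact ⟨q, hq.symm⟩
  obtain ⟨e, het, hec, hcases, he_conj, he_sign, -⟩ := exists_frame hττ hdich ht hti hK h6
  refine ⟨t, e, ht, hti, htcov, het, hec, hcases, he_conj, he_sign, fun s => ?_⟩
  -- the type read in the frame
  have hmemt : ∀ q, t q ∈ Φ.1 ↔ q = p₀ := fun q => by
    constructor
    · intro h
      exact ht (((hmem₀ (t q)).1 ⟨hti q, h⟩).trans htp₀.symm)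
    · rintro rfl
      rw [htp₀]; exact hs₀Φ
  obtain ⟨q, rfl | rfl⟩ := hcases s
  · rw [het, hmemt]
    simp
  · rw [hec, Φ.2, ComplexEmbedding.involutive_conjugate K, hmemt]
    simp

end OneType

end Summit.HodgeConjecture.CorCM.TwoSexticFields

end
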